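import Summits.BirchSwinnertonDyer.Rank1Residual.Additive.X3BranchLayerKummerZeta27
import Summits.BirchSwinnertonDyer.Rank1Residual.Additive.X3BranchLayerThreeZeta81
import Summits.BirchSwinnertonDyer.Rank1Residual.Additive.X3BranchLayerCharTowerBase
import HarnessLib

/-!
# X3, the DEGENERATE rows OFF the sub-locus, T-SIDE OVER THE SECOND LAYER: STEP 3 of the independence
# argument — on `Gal(ℚ̄/ℚ(ζ₂₇))` an additive character of the SECOND layer group that dies on `G_{ℚ_∞}`
# is a multiple of the KUMMER CHARACTER OF `ζ₂₇`, so a radical it governs is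
# `ζ₈₁^c · (element of ℚ(ζ₂₇))` (cell `bsd-eis`, seat `bsd-eis-x3` gen 8; the file
# `X3BranchLayerKummerZeta27.lean` one level up, assembled from `LayerCharTowerBase` (base layer `2`),
# `LayerThreeZeta81` and gen 7's `KummerLayerTwisted.exists_aeval_of_forall_smul_eq`; x3-MEMO-10 §5 (f);
# route K1 `AdditiveBranchIMC`, crux `GordTwoRankZeroOffCaseOne` — supports only)

HONEST FRAMING (`run/shared/lean/pub/bsd-eis/README.md` §4): THEOREMS ONLY (no `def`, no named fact,
no `sorry`); nothing is booked; no label, tier or count of record moves.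

## What

`κ` cyclotomic (`p = 3`), `L_n = κ.layerSubgroup n`, `ζ` a primitive `81`-st root of unity
(`ζ₂₇ = ζ³`, `ζ₉ = ζ⁹`, `ζ₃ = ζ²⁷`), `ψ : Γ_ℚ → ℤ/3` locally constant, additive on `L₂`, zero on `ker κ`,
and `X ∈ ℚ̄` with `σX = ζ₃^{ψ σ}·X` for every `σ ∈ L₂` fixing `ζ₃`. Then `X = ζ^c · G(ζ₂₇)` for some
`c ∈ ℕ`, `G ∈ ℚ[X]` (`exists_eq_zeta81_pow_mul_aeval`). Ingredients:
* `exists_smul_zeta81_eq` — `σ ∈ L₂ ∩ Stab(ζ₃)` maps `ζ` to `ζ₃^e ζ` (it fixes `ζ₂₇`, gen 7);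
* `pow_nine_smul_zeta81_ne` — `γ⁹` MOVES `ζ` (else `γ⁹ ∈ Gal(ℚ̄/ℚ(μ₈₁)) ≤ L₃`, but `κ γ⁹ = 9`);
* `exists_forall_smul_mul_inv_zeta81_pow_eq` — WLOG `γ` fixes `ζ₃`; `ψ σ = j·ψ(γ⁹)` for
  `σ = h(γ⁹)^j`, `h ∈ L₃` (`LayerCharTowerBase`); on `Stab(ζ₂₇) ⊆ L₂ ∩ Stab(ζ₃)`, `h` fixes `ζ`
  (`smul_zeta81_eq_of_mem_layerSubgroup_three`) and `σζ = ζ₃^{ej}ζ`, so `X·ζ^{-c}` with `c ≡ e·ψ(γ⁹)`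
  is FIXED by `Stab(ζ₂₇)`; then Krull–Galois (`exists_aeval_of_forall_smul_eq`).
References: [Washington1997] §13.1; [SerreLocalFields1979] Ch. X §3; [NeukirchANT1999] Ch. IV §1.
-/

set_option autoImplicit false

noncomputable section

namespace Summit.BirchSwinnertonDyer.Rank1Residual.Additive

namespace LayerCharTower

open Field Polynomial IntermediateField
open Literature.NumberTheory.GaloisRepresentations
open Literature.NumberTheory.EllipticCurves
open Summit.BirchSwinnertonDyer.Rank1Residual.Iwasawa.CyclotomicLayerOne

/-! ### §1 `ζ₈₁` under `L₂ ∩ Stab(ζ₃)` -/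

/-- **`σ ∈ L₂ ∩ Stab(ζ₃)` maps `ζ₈₁` to `ζ₃^e·ζ₈₁`** (`σ` fixes `ζ₂₇ = ζ₈₁³` by gen 7's
`smul_zeta27_eq_of_mem_layerSubgroup_two`, so `σζ₈₁/ζ₈₁` is a cube root of unity).
[cite: Washington1997, §13.1] -/
theorem exists_smul_zeta81_eq {κ : ZpExtension ℚ 3} (hκ : κ.IsCyclotomic)
    {ζ : AlgebraicClosure ℚ} (hζ : IsPrimitiveRoot ζ 81) {σ : absoluteGaloisGroup ℚ}
    (hσ : σ ∈ κ.layerSubgroup 2) (h27 : σ • ζ ^ 27 = ζ ^ 27) :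
    ∃ e : ℕ, e < 3 ∧ σ • ζ = (ζ ^ 27) ^ e * ζ := by
  have hζ27 : IsPrimitiveRoot (ζ ^ 3) 27 := hζ.pow (by norm_num) (by norm_num)
  have hζ3 : IsPrimitiveRoot (ζ ^ 27) 3 := hζ.pow (by norm_num) (by norm_num)
  have h9' : σ • (ζ ^ 3) ^ 9 = (ζ ^ 3) ^ 9 := by rw [← pow_mul]; exact h27
  have hfix3 : σ • ζ ^ 3 = ζ ^ 3 := smul_zeta27_eq_of_mem_layerSubgroup_two hκ hσ hζ27 h9'
  have hζ0 : ζ ≠ 0 := hζ.ne_zero (by norm_num)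
  have hq : (σ • ζ * ζ⁻¹) ^ 3 = 1 := by
    rw [mul_pow, ← smul_pow', hfix3, inv_pow, mul_inv_cancel₀ (pow_ne_zero 3 hζ0)]
  obtain ⟨e, he, hζe⟩ := hζ3.eq_pow_of_pow_eq_one hq
  exact ⟨e, he, by rw [hζe, inv_mul_cancel_right₀ hζ0]⟩

/-- **`γ⁹` MOVES `ζ₈₁`** for a topological generator `γ` of a cyclotomic `κ`: otherwise `γ⁹` fixes
all `81`-st roots of unity, hence lies in `κ.layerSubgroup 3`
(`IsCyclotomic.rootsOfUnityFixer_le_layerSubgroup`), i.e. `27 ∣ κ(γ⁹) = 9`. [cite: Washington1997, §13.1] -/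
theorem pow_nine_smul_zeta81_ne {κ : ZpExtension ℚ 3} (hκ : κ.IsCyclotomic)
    {γ : absoluteGaloisGroup ℚ} (hγ : κ.IsTopGenerator γ)
    {ζ : AlgebraicClosure ℚ} (hζ : IsPrimitiveRoot ζ 81) : γ ^ 9 • ζ ≠ ζ := by
  intro h
  have hmem : γ ^ 9 ∈ rootsOfUnityFixer ℚ (3 ^ (3 + 1)) := by
    intro t ht
    have ht' : t ^ 81 = 1 := by norm_num at ht; exact ht
    obtain ⟨k, -, rfl⟩ := hζ.eq_pow_of_pow_eq_one ht'
    rw [smul_pow', h]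
  have h2 : γ ^ 9 ∈ κ.layerSubgroup 3 :=
    hκ.rootsOfUnityFixer_le_layerSubgroup (by norm_num) 3 hmem
  rw [ZpExtension.mem_layerSubgroup, map_pow, show κ γ = Multiplicative.ofAdd 1 from hγ,
    ← ofAdd_nsmul, toAdd_ofAdd, nsmul_eq_mul, mul_one] at h2
  have h3 : ((3 : ℤ_[3])) ^ 3 ∣ ((9 : ℤ) : ℤ_[3]) := by
    have : ((9 : ℤ) : ℤ_[3]) = ((9 : ℕ) : ℤ_[3]) := by norm_cast
    rw [this]; exact_mod_cast h2
  have h4 : ((3 : ℕ) : ℤ_[3]) ^ 3 ∣ ((9 : ℤ) : ℤ_[3]) := by exact_mod_cast h3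
  rw [PadicInt.pow_p_dvd_int_iff] at h4
  norm_num at h4

/-! ### §2 STEP 3: the radical is `ζ₈₁^c` times an element of `ℚ(ζ₂₇)` -/

/-- **STEP 3 (core) over the second layer.** `κ` cyclotomic, `ζ` a primitive `81`-st root of unity,
`ψ : Γ_ℚ → ℤ/3` locally constant, additive on `L₂ = κ.layerSubgroup 2` and zero on `ker κ`, `X ∈ ℚ̄`
with `σX = (ζ²⁷)^{(ψ σ).val}·X` for all `σ ∈ L₂` fixing `ζ²⁷`. Then for some `c ∈ ℕ` the element
`X·(ζ^c)⁻¹` is FIXED by every `σ ∈ Γ_ℚ` fixing `ζ₂₇ = ζ³`. [cite: Washington1997, §13.1]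
[cite: SerreLocalFields1979, Ch. X §3] -/
theorem exists_forall_smul_mul_inv_zeta81_pow_eq {κ : ZpExtension ℚ 3} (hκ : κ.IsCyclotomic)
    {ζ : AlgebraicClosure ℚ} (hζ : IsPrimitiveRoot ζ 81)
    {ψ : absoluteGaloisGroup ℚ → ZMod 3} (hlc : IsLocallyConstant ψ)
    (hadd : ∀ a ∈ κ.layerSubgroup 2, ∀ b ∈ κ.layerSubgroup 2, ψ (a * b) = ψ a + ψ b)
    (hker : ∀ σ ∈ κ.kerSubgroup, ψ σ = 0)
    {X : AlgebraicClosure ℚ}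
    (hX : ∀ σ ∈ κ.layerSubgroup 2, σ • ζ ^ 27 = ζ ^ 27 → σ • X = (ζ ^ 27) ^ (ψ σ).val * X) :
    ∃ c : ℕ, ∀ σ : absoluteGaloisGroup ℚ, σ • ζ ^ 3 = ζ ^ 3 →
      σ • (X * (ζ ^ c)⁻¹) = X * (ζ ^ c)⁻¹ := by
  have hζ3 : IsPrimitiveRoot (ζ ^ 27) 3 := hζ.pow (by norm_num) (by norm_num)
  have hζ27 : IsPrimitiveRoot (ζ ^ 3) 27 := hζ.pow (by norm_num) (by norm_num)
  have hζ0 : ζ ≠ 0 := hζ.ne_zero (by norm_num)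
  -- WLOG the generator fixes `ζ₃ = ζ²⁷`
  obtain ⟨κ', hκ', hlay, hker', γ, hγ, hγN⟩ := exists_isCyclotomic_isTopGenerator_smul_eq hκ hζ3
  have hadd' : ∀ a ∈ κ'.layerSubgroup 2, ∀ b ∈ κ'.layerSubgroup 2, ψ (a * b) = ψ a + ψ b := by
    rw [hlay]; exact hadd
  have hkerψ : ∀ σ ∈ κ'.kerSubgroup, ψ σ = 0 := by rw [hker']; exact hker
  have hX' : ∀ σ ∈ κ'.layerSubgroup 2, σ • ζ ^ 27 = ζ ^ 27 → σ • X = (ζ ^ 27) ^ (ψ σ).val * X := by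
    rw [hlay]; exact hX
  -- STEP 1: `ψ` vanishes on some `L_m`, hence on `L_{m+2+2}`
  obtain ⟨m, hm⟩ := exists_layerSubgroup_subset_of_isLocallyConstant κ' hlc hkerψ
  have hvan : ∀ σ ∈ κ'.layerSubgroup (m + 2 + 2), ψ σ = 0 := fun σ hσ ↦
    hm σ (κ'.layerSubgroup_antitone (by omega) hσ)
  -- `γ⁹ ∈ L₂` fixes `ζ²⁷`, maps `ζ ↦ (ζ²⁷)^e ζ` with `e ≠ 0`
  have hγ9 : γ ^ 3 ^ 2 = γ ^ 9 := by norm_num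
  have hγ9L2 : γ ^ 9 ∈ κ'.layerSubgroup 2 := by
    have h := pow_mem_layerSubgroup κ' hγ 2
    rwa [hγ9] at h
  have hγ9N : γ ^ 9 • ζ ^ 27 = ζ ^ 27 := pow_smul_eq_self hγN 9
  obtain ⟨e, -, hγe⟩ := exists_smul_zeta81_eq hκ' hζ hγ9L2 hγ9N
  have he0 : (e : ZMod 3) ≠ 0 := by
    intro he
    have he' : e % 3 = 0 := by
      have := (ZMod.natCast_eq_zero_iff e 3).mp he
      omega
    apply pow_nine_smul_zeta81_ne hκ' hγ hζ
    rw [hγe, ← Nat.div_add_mod e 3, he', add_zero, pow_mul, hζ3.pow_eq_one, one_pow, one_mul]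
  have hee : (e : ZMod 3) * e = 1 := by
    have hcases : ∀ z : ZMod 3, z ≠ 0 → z * z = 1 := by decide
    exact hcases _ he0
  -- powers of `γ⁹` on `ζ²⁷` and on `ζ`
  have hγ9k27 : ∀ k : ℕ, (γ ^ 9) ^ k • ζ ^ 27 = ζ ^ 27 := pow_smul_eq_self hγ9N
  have hγ9kζ : ∀ k : ℕ, (γ ^ 9) ^ k • ζ = (ζ ^ 27) ^ (e * k) * ζ := by
    intro k
    induction k with
    | zero => rw [pow_zero, one_smul, mul_zero, pow_zero, one_mul]
    | succ k ih =>
      rw [pow_succ, mul_smul, hγe, smul_mul', smul_pow', hγ9k27 k, ih, ← mul_assoc, ← pow_add]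
      congr 2
      ring
  set a : ZMod 3 := ψ (γ ^ 9) with ha
  refine ⟨e * a.val, fun σ hσ3 ↦ ?_⟩
  -- `σ` fixes `ζ²⁷` and lies in `L₂`
  have hσ27 : σ • ζ ^ 27 = ζ ^ 27 := by
    rw [show ζ ^ 27 = (ζ ^ 3) ^ 9 by ring, smul_pow', hσ3]
  have hσL2 : σ ∈ κ'.layerSubgroup 2 := by
    refine hκ'.rootsOfUnityFixer_le_layerSubgroup (by norm_num) 2 ?_
    intro t ht
    have ht' : t ^ 27 = 1 := by norm_num at ht; exact ht
    obtain ⟨k, -, rfl⟩ := hζ27.eq_pow_of_pow_eq_one ht'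
    rw [smul_pow', hσ3]
  -- STEP 2: `σ = h (γ⁹)^j`, `h ∈ L₃`, `ψ σ = j·a`
  obtain ⟨h, j, hh3, hσeq, hψσ⟩ := exists_addCharOnBase_eq_mul κ' hadd' hγ m hvan hσL2
  rw [hγ9] at hσeq hψσ
  -- `h` fixes `ζ²⁷`, hence `ζ`
  have hh27 : h • ζ ^ 27 = ζ ^ 27 := by
    have hh : h = σ * ((γ ^ 9) ^ j)⁻¹ := by rw [hσeq, mul_inv_cancel_right]
    rw [hh, mul_smul, inv_smul_eq_iff.mpr (hγ9k27 j).symm, hσ27]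
  have hhζ : h • ζ = ζ := smul_zeta81_eq_of_mem_layerSubgroup_three hκ' hh3 hζ hh27
  -- `σζ = (ζ²⁷)^{ej} ζ`
  have hσζ : σ • ζ = (ζ ^ 27) ^ (e * j) * ζ := by
    rw [hσeq, mul_smul, hγ9kζ j, smul_mul', smul_pow', smul_pow', hhζ]
  -- `σX = (ζ²⁷)^{(j a).val} X`
  have hXσ := hX' σ hσL2 hσ27
  rw [hψσ] at hXσ
  -- exponent bookkeeping modulo `3`
  have hexp : ((((j : ZMod 3) * a).val : ℕ) : ZMod 3) = ((e * j * (e * a.val) : ℕ) : ZMod 3) := by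
    rw [ZMod.natCast_zmod_val]
    push_cast
    rw [ZMod.natCast_zmod_val]
    linear_combination (-(j : ZMod 3) * a) * hee
  have hpow : (ζ ^ 27) ^ (((j : ZMod 3) * a).val) = (ζ ^ 27) ^ (e * j * (e * a.val)) :=
    pow_eq_pow_of_natCast_eq hζ3 hexp
  rw [smul_mul', smul_inv'', smul_pow', hσζ, hXσ, hpow, mul_pow, ← pow_mul]
  have hne : (ζ ^ 27) ^ (e * j * (e * a.val)) ≠ 0 := pow_ne_zero _ (pow_ne_zero _ hζ0)
  have hne' : ζ ^ (e * a.val) ≠ 0 := pow_ne_zero _ hζ0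
  field_simp
  ring

/-- **STEP 3 over the second layer.** Under the hypotheses of
`exists_forall_smul_mul_inv_zeta81_pow_eq`: `X = ζ^c · G(ζ³)` for some `c ∈ ℕ` and `G ∈ ℚ[X]`
(Krull–Galois at `ℚ(ζ₂₇)`, gen 7's `KummerLayerTwisted.exists_aeval_of_forall_smul_eq`).
[cite: Washington1997, §13.1] [cite: NeukirchANT1999, Ch. IV §1] -/
theorem exists_eq_zeta81_pow_mul_aeval {κ : ZpExtension ℚ 3} (hκ : κ.IsCyclotomic)
    {ζ : AlgebraicClosure ℚ} (hζ : IsPrimitiveRoot ζ 81)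
    {ψ : absoluteGaloisGroup ℚ → ZMod 3} (hlc : IsLocallyConstant ψ)
    (hadd : ∀ a ∈ κ.layerSubgroup 2, ∀ b ∈ κ.layerSubgroup 2, ψ (a * b) = ψ a + ψ b)
    (hker : ∀ σ ∈ κ.kerSubgroup, ψ σ = 0)
    {X : AlgebraicClosure ℚ}
    (hX : ∀ σ ∈ κ.layerSubgroup 2, σ • ζ ^ 27 = ζ ^ 27 → σ • X = (ζ ^ 27) ^ (ψ σ).val * X) :
    ∃ (c : ℕ) (G : ℚ[X]), X = ζ ^ c * aeval (ζ ^ 3) G := by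
  obtain ⟨c, hc⟩ := exists_forall_smul_mul_inv_zeta81_pow_eq hκ hζ hlc hadd hker hX
  have hint : IsIntegral ℚ (ζ ^ 3) :=
    ((hζ.pow (by norm_num) (by norm_num) : IsPrimitiveRoot (ζ ^ 3) 27).isIntegral
      (by norm_num)).tower_top
  obtain ⟨G, hG⟩ := KummerLayerTwisted.exists_aeval_of_forall_smul_eq hint hc
  have hζ0 : ζ ≠ 0 := hζ.ne_zero (by norm_num)
  refine ⟨c, G, ?_⟩
  rw [← hG, mul_comm, inv_mul_cancel_right₀ (pow_ne_zero c hζ0)]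

end LayerCharTower

end Summit.BirchSwinnertonDyer.Rank1Residual.Additive

end
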